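import Summits.QuantumFields.YangMills.Theorems.BalabanUVNodesPortU8LocResponse
import Summits.QuantumFields.YangMills.Theorems.BalabanUVNodesPortU8IotaC2Transport
import Literature.MathematicalPhysics.QuantumFieldTheory.Balaban1983to89.Node00.CriticalOnFibreTopGuardedBPrint
import Literature.MathematicalPhysics.QuantumFieldTheory.Balaban1983to89.Node00.Record12BgRowCoClassCPMFloorB
import Literature.MathematicalPhysics.QuantumFieldTheory.Balaban1983to89.Node00.TorusCoverGaugeTokensGuardedB

/-!
# PORT PT-B (U8), g3 file 2 — THE SKELETON AGAINST 27931 ⁷⁗ «v10-Loc» (`d796c7a1386a82f1`, SIGNED 2026-08-31T02:54:19Z, RENDERED rev 35; director-ym №494∕№495: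
# V11 BUILD = GO, CLOSE = HOLD): the signed text, VERBATIM, FROM the window TRANSPORT identity (R4ᴰ-Loc) ALONE — (R1ᴰ-Loc) for the chart-unit □₀-localized response
# `recordGkLocAtξ` is DISCHARGED by the text's own TokP9L4-Loc token through g3 file 1 (`rowR1D_Loc_at`), the `𝐉`-block by port M at the localized configuration
# (`recordJLocξ_eq`), (C2a)(C2b) by g0 files 1∕5, (R0)(R3)(R5) by g0 files 2–3 — `--supports stmt-QuantumFields-27931` (conditional on the transport identity; NOT a closer)

Cell `ym-nodeO-ideate` ∕ `ym-balaban-port`, porter `ymgap-nodeO-port-PTB-1` (gen 3), item **stmt-QuantumFields-27931** `BalabanUVNodes.PortPieceLocalityU8`.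
[I] = [Balaban1987RG1], [15] = [Balaban1985Variational], [B6] = [Balaban1984PropagatorsII].

WHAT THIS FILE PROVES (one theorem; no `def ∕ instance ∕ notation ∕ sorry`; standard axioms): ★★★ `portPieceLocalityU8_v11_of hT : <v10-Loc verbatim>` — `hT` = the
window TRANSPORT IDENTITY: under `NoWrapAt` at the members `n` and `n + 1` (and `X` off the wrap class, label `2|z| < recordRNat`), the chart-unit localized response of member
`n + 1` at the lifted label, read on the centred-lifted chart inputs of `X`, EQUALS that of member `n` — so the two-volume cut difference is `0` and (R4ᴰ-Loc) holds with ANY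
constants ([I] (1.21) p.264: the window problem does not see the volume).  RESIDUE OF v10-Loc = EXACTLY {`hT`} (g3 file 3, the uniqueness-transport lemma over [B6]
`existsUnique_isCritical_V1`, in progress).  Constants: `C₉ := 2(2C₉′ + 2‖π_ℝ‖C₉′ + 1)e^{4δ₉Mc}∕α₂`, `δ₀ := δ₉`.
HONEST FRAMING.  A conditional assembly; NOTHING of Bałaban's analysis asserted, ported or discharged; 27931 OPEN · SIGNED v10-Loc · close on HOLD (№495) — this file cannot and
does not close it (`hT` displayed); K0⁷ NOT closed; NODE O 0∕1; COUNT 8∕28 · K 1∕4 UNMOVED; finite `𝕋⁴_{L^K}` at fixed ε — NOT continuum ∕ OS ∕ Clay; **the Yang–Mills mass gap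
(Clay) is NOT proved.**
-/

noncomputable section

open scoped BigOperators Matrix.Norms.L2Operator

namespace Summit.QuantumFields.YangMills.Theorems.PortU8

open Literature.MathematicalPhysics.QuantumFieldTheory.Balaban1983to89
open Literature.MathematicalPhysics.QuantumFieldTheory.Balaban1983to89.Node00
open Literature.MathematicalPhysics.QuantumFieldTheory.Balaban1983to89.T4Continuum (T4Family)
open Summit.QuantumFields.YangMills.Theorems.K0RecordFormatNames

/-- ★★★ **THE SKELETON AGAINST 27931 v10-Loc** (`d796c7a1386a82f1`, the SIGNED and RENDERED string of record): the signed text, verbatim, FROM the window transport identity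
`hT` (R4ᴰ-Loc with left side `0`); (R1ᴰ-Loc) comes from the TokP9L4-Loc token via `rowR1D_Loc_at` (the token's □₃-guard on the coarse source of a bond of `X` IS the row's inner
guard on the label over that chart input), everything else from g0∕g3 files.  Conditional: closes nothing; residue of v10-Loc = EXACTLY {`hT`}.
[cite: Balaban1987RG1, (1.7)–(1.8) p.261, (1.21) p.264, (4.2)–(4.5) pp.281–282, (4.35) p.290, (3.37) p.277; Balaban1985Variational, Prop. 9 p.309, (190) p.308; Balaban1984PropagatorsII, (2.35) p.228] -/
theorem portPieceLocalityU8_v11_of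
    (hT : ∀ (F : Literature.MathematicalPhysics.QuantumFieldTheory.Balaban1983to89.T4Continuum.T4Family) (Mc k : ℕ) (a₀ ε₂₉ : ℝ)
      (a : (Summit.QuantumFields.YangMills.Theorems.K0RecordFormatNames.thetaFill F a₀ ε₂₉).ιβ) (z₀ : Fin 4 → ℤ) (n : ℕ)
      (X : (Summit.QuantumFields.YangMills.Theorems.K0RecordFormatNames.recordDomSys F Mc k (Summit.QuantumFields.YangMills.Theorems.K0RecordFormatNames.recordK₀ F Mc k + n)).Dom),
      Summit.QuantumFields.YangMills.Theorems.K0RecordFormatNames.McGuard F Mc →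
      X ∉ Summit.QuantumFields.YangMills.Theorems.K0RecordFormatNames.recordWrapCtr F Mc k (Summit.QuantumFields.YangMills.Theorems.K0RecordFormatNames.recordK₀ F Mc k + n) →
      Summit.QuantumFields.YangMills.Theorems.K0RecordFormatNames.NoWrapAt F k (Summit.QuantumFields.YangMills.Theorems.K0RecordFormatNames.recordK₀ F Mc k + n)
        (Summit.QuantumFields.YangMills.Theorems.K0RecordFormatNames.nestRadius Mc 5) z₀ →
      Summit.QuantumFields.YangMills.Theorems.K0RecordFormatNames.NoWrapAt F k (Summit.QuantumFields.YangMills.Theorems.K0RecordFormatNames.recordK₀ F Mc k + (n + 1))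
        (Summit.QuantumFields.YangMills.Theorems.K0RecordFormatNames.nestRadius Mc 5) z₀ →
      ∀ (μ : Fin 4) (z : Fin 4 → ℤ), (∀ l, 2 * |z l| < (Summit.QuantumFields.YangMills.Theorems.K0RecordFormatNames.recordRNat F Mc k
        (Summit.QuantumFields.YangMills.Theorems.K0RecordFormatNames.recordK₀ F Mc k + n) : ℤ)) →
      ∀ i ∈ Summit.QuantumFields.YangMills.Theorems.K0RecordFormatNames.recordCXJ F Mc k (Summit.QuantumFields.YangMills.Theorems.K0RecordFormatNames.recordK₀ F Mc k + n) X,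
        Summit.QuantumFields.YangMills.Theorems.K0RecordFormatNames.recordGkLocAtξ F (Summit.QuantumFields.YangMills.Theorems.K0RecordFormatNames.thetaFill F a₀ ε₂₉) k
            (Summit.QuantumFields.YangMills.Theorems.K0RecordFormatNames.recordK₀ F Mc k + (n + 1)) (Summit.QuantumFields.YangMills.Theorems.K0RecordFormatNames.nestRadius Mc 5) z₀ a
            (Summit.QuantumFields.YangMills.Theorems.K0RecordFormatNames.recordE F k (Summit.QuantumFields.YangMills.Theorems.K0RecordFormatNames.recordK₀ F Mc k + (n + 1)) μ z)
            (Summit.QuantumFields.YangMills.Theorems.K0RecordFormatNames.recordJXJ F (Summit.QuantumFields.YangMills.Theorems.K0RecordFormatNames.recordK₀ F Mc k + n) i) =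
          Summit.QuantumFields.YangMills.Theorems.K0RecordFormatNames.recordGkLocAtξ F (Summit.QuantumFields.YangMills.Theorems.K0RecordFormatNames.thetaFill F a₀ ε₂₉) k
            (Summit.QuantumFields.YangMills.Theorems.K0RecordFormatNames.recordK₀ F Mc k + n) (Summit.QuantumFields.YangMills.Theorems.K0RecordFormatNames.nestRadius Mc 5) z₀ a
            (Summit.QuantumFields.YangMills.Theorems.K0RecordFormatNames.recordE F k (Summit.QuantumFields.YangMills.Theorems.K0RecordFormatNames.recordK₀ F Mc k + n) μ z) i) :
    ∀ (F : Literature.MathematicalPhysics.QuantumFieldTheory.Balaban1983to89.T4Continuum.T4Family) (Mc : ℕ) (j c c₀ c₁ : ℕ) (B₃ B₃' a₀ a₁ : ℝ), Summit.QuantumFields.YangMills.Theorems.K0RecordFormatNames.McGuard F Mc → c ≤ F.L ^ j → c₀ ≤ j + 1 → c₁ ≤ j → 2 * (F.L : ℝ) ^ 2 ≤ B₃ → 0 < B₃' → 0 < a₀ → 0 < a₁ → Literature.MathematicalPhysics.QuantumFieldTheory.Balaban1983to89.Node00.VariationalThm1RegSepCoP7MGB F 2 (fun ν M g K k _s =>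 c ≤ ν.M₁ ∧ k + c₀ ≤ F.m + K ∧ F.L ^ c₁ ∣ M ∧ ∀ i, 1 ≤ i → i ≤ k → Literature.MathematicalPhysics.QuantumFieldTheory.Balaban1983to89.Node00.dCubeSide (F.P K).L M (Literature.MathematicalPhysics.QuantumFieldTheory.Balaban1983to89.Node00.RkOfRecord (F.P K).L ν.r (g i)) i ∣ (F.P K).sitesPerDir 0) (Literature.MathematicalPhysics.QuantumFieldTheory.Balaban1983to89.Node00.lamDatum F) (Literature.MathematicalPhysics.QuantumFieldTheory.Balaban1983to89.Node00.dataSmall7LamTopOf F 2) B₃ a₀ a₁ → Literature.MathematicalPhysics.QuantumFieldTheory.Balaban1983to89.Node00.Gauge9RegSepTopStepGB F 2 (fun ν K Ω => Literature.MathematicalPhysics.QuantumFieldTheory.Balaban1983to89.Node00.suppDomOfRecord F ν K Ω) (F.L ^ j) (fun ν M g K k _s => c ≤ ν.M₁ ∧ k + c₀ ≤ F.m + K ∧ F.L ^ c₁ ∣ M ∧ ∀ i, 1 ≤ i → i ≤ k → Literature.MathematicalPhysics.QuantumFieldTheory.Balaban1983to89.Node00.dCubeSide (F.P K).L M (Literature.MathematicalPhysics.QuantumFieldTheory.Balaban1983to89.Node00.RkOfRecord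 (F.P K).L ν.r (g i)) i ∣ (F.P K).sitesPerDir 0) (Literature.MathematicalPhysics.QuantumFieldTheory.Balaban1983to89.Node00.lamDatum F) (Literature.MathematicalPhysics.QuantumFieldTheory.Balaban1983to89.Node00.dataSmall7LamTopOf F 2) B₃ B₃' a₀ a₁ → (∀ ε₁ : ℝ, 0 < ε₁ → ε₁ ≤ a₁ → B₃ * ε₁ ≤ a₀ → ∀ (k n : ℕ) (V : Literature.MathematicalPhysics.QuantumFieldTheory.Balaban1983to89.GaugeField (F.P (Summit.QuantumFields.YangMills.Theorems.K0RecordFormatNames.recordK₀ F Mc k + n)) (k + 1) (Literature.MathematicalPhysics.QuantumFieldTheory.Balaban1983to89.Node00.SU 2)), Literature.MathematicalPhysics.QuantumFieldTheory.Balaban1983to89.PlaqSmall ε₁ V → Literature.MathematicalPhysics.QuantumFieldTheory.Balaban1983to89.Node00.UkExists F 2 (Summit.QuantumFields.YangMills.Theorems.K0RecordFormatNames.recordK₀ F Mc k + n) (k + 1) a₀ V ∧ Literature.MathematicalPhysics.QuantumFieldTheory.Balaban1983to89.Node00.UniqueUkOrbit F 2 (Summit.QuantumFields.YangMills.Theorems.K0RecordFormatNames.recordK₀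 F Mc k + n) (k + 1) a₀ V) → (∀ (k n : ℕ) (ε₂₉ : ℝ), 0 < ε₂₉ → letI θ := Summit.QuantumFields.YangMills.Theorems.K0RecordFormatNames.thetaFill F a₀ ε₂₉; letI := θ.instVβ₁; letI := θ.instVβ₂; letI := θ.instιβ; AnalyticAt ℝ (fun B : Summit.QuantumFields.YangMills.Theorems.K0RecordFormatNames.recordW F a₀ ε₂₉ k (Summit.QuantumFields.YangMills.Theorems.K0RecordFormatNames.recordK₀ F Mc k + n) => fun (b : Literature.MathematicalPhysics.QuantumFieldTheory.Balaban1983to89.PBond (F.P (Summit.QuantumFields.YangMills.Theorems.K0RecordFormatNames.recordK₀ F Mc k + n)) 0) (i i' : Fin 2) => ((Summit.QuantumFields.YangMills.Theorems.K0RecordFormatNames.recordBgField F θ k (Summit.QuantumFields.YangMills.Theorems.K0RecordFormatNames.recordK₀ F Mc k + n) B b : Literature.MathematicalPhysics.QuantumFieldTheory.Balaban1983to89.Node00.SU 2) : Matrix (Fin 2) (Fin 2) ℂ) i i') 0) → (∃ C₉' δ₉ : ℝ, 0 ≤ C₉' ∧ 0 < δ₉ ∧ ∀ (k n : ℕ)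 (ε₂₉ : ℝ), 0 < ε₂₉ → letI θ := Summit.QuantumFields.YangMills.Theorems.K0RecordFormatNames.thetaFill F a₀ ε₂₉; letI := θ.instVβ₁; letI := θ.instVβ₂; letI := θ.instιβ; ∀ (a : θ.ιβ) (μ : Fin (F.P (Summit.QuantumFields.YangMills.Theorems.K0RecordFormatNames.recordK₀ F Mc k + n)).d) (y : Literature.MathematicalPhysics.QuantumFieldTheory.Balaban1983to89.Site (F.P (Summit.QuantumFields.YangMills.Theorems.K0RecordFormatNames.recordK₀ F Mc k + n)) (k + 1)), ∀ z₀ : Fin 4 → ℤ, Summit.QuantumFields.YangMills.Theorems.K0RecordFormatNames.NoWrapAt F k (Summit.QuantumFields.YangMills.Theorems.K0RecordFormatNames.recordK₀ F Mc k + n) (Summit.QuantumFields.YangMills.Theorems.K0RecordFormatNames.nestRadius Mc 5) z₀ → letI Hr : Literature.MathematicalPhysics.QuantumFieldTheory.Balaban1983to89.PBond (F.P (Summit.QuantumFields.YangMills.Theorems.K0RecordFormatNames.recordK₀ F Mc k + n)) 0 → Fin 2 → Fin 2 → ℂ := fun b' => Summit.QuantumFields.YangMills.Theorems.K0RecordFormatNames.recordHrLocξ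 F θ k (Summit.QuantumFields.YangMills.Theorems.K0RecordFormatNames.recordK₀ F Mc k + n) (Summit.QuantumFields.YangMills.Theorems.K0RecordFormatNames.recordWindow F k (Summit.QuantumFields.YangMills.Theorems.K0RecordFormatNames.recordK₀ F Mc k + n) (Summit.QuantumFields.YangMills.Theorems.K0RecordFormatNames.nestRadius Mc 5) z₀) a (μ, y) b'; ∀ b : Literature.MathematicalPhysics.QuantumFieldTheory.Balaban1983to89.PBond (F.P (Summit.QuantumFields.YangMills.Theorems.K0RecordFormatNames.recordK₀ F Mc k + n)) 0, Summit.QuantumFields.YangMills.Theorems.K0RecordFormatNames.coarsenTo (k + 1) b.src ∈ Summit.QuantumFields.YangMills.Theorems.K0RecordFormatNames.recordWindow F k (Summit.QuantumFields.YangMills.Theorems.K0RecordFormatNames.recordK₀ F Mc k + n) (Summit.QuantumFields.YangMills.Theorems.K0RecordFormatNames.nestRadius Mc 3) z₀ → ‖Hr b‖ ≤ C₉' * (F.P (Summit.QuantumFields.YangMills.Theorems.K0RecordFormatNames.recordK₀ F Mc k + n)).eta (k + 1) * Real.exp (-(δ₉ * (Literature.MathematicalPhysics.QuantumFieldTheory.Balaban1983to89.Site.tdist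 (Summit.QuantumFields.YangMills.Theorems.K0RecordFormatNames.coarsenTo (k + 1) b.src) y : ℝ))) ∧ (∀ ν : Fin (F.P (Summit.QuantumFields.YangMills.Theorems.K0RecordFormatNames.recordK₀ F Mc k + n)).d, ‖Hr (⟨b.src.shift ν, b.dir⟩ : Literature.MathematicalPhysics.QuantumFieldTheory.Balaban1983to89.PBond (F.P (Summit.QuantumFields.YangMills.Theorems.K0RecordFormatNames.recordK₀ F Mc k + n)) 0) - Hr b‖ ≤ C₉' * (F.P (Summit.QuantumFields.YangMills.Theorems.K0RecordFormatNames.recordK₀ F Mc k + n)).eta (k + 1) ^ 2 * Real.exp (-(δ₉ * (Literature.MathematicalPhysics.QuantumFieldTheory.Balaban1983to89.Site.tdist (Summit.QuantumFields.YangMills.Theorems.K0RecordFormatNames.coarsenTo (k + 1) b.src) y : ℝ)))) ∧ ‖∑ ν : Fin (F.P (Summit.QuantumFields.YangMills.Theorems.K0RecordFormatNames.recordK₀ F Mc k + n)).d, (Hr (⟨b.src.shift ν, b.dir⟩ : Literature.MathematicalPhysics.QuantumFieldTheory.Balaban1983to89.PBond (F.P (Summit.QuantumFields.YangMills.Theorems.K0RecordFormatNames.recordK₀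 F Mc k + n)) 0) - (2 : ℂ) • Hr b + Hr (⟨b.src.unshift ν, b.dir⟩ : Literature.MathematicalPhysics.QuantumFieldTheory.Balaban1983to89.PBond (F.P (Summit.QuantumFields.YangMills.Theorems.K0RecordFormatNames.recordK₀ F Mc k + n)) 0))‖ ≤ C₉' * (F.P (Summit.QuantumFields.YangMills.Theorems.K0RecordFormatNames.recordK₀ F Mc k + n)).eta (k + 1) ^ 3 * Real.exp (-(δ₉ * (Literature.MathematicalPhysics.QuantumFieldTheory.Balaban1983to89.Site.tdist (Summit.QuantumFields.YangMills.Theorems.K0RecordFormatNames.coarsenTo (k + 1) b.src) y : ℝ))) ∧ ‖∑ ν : Fin (F.P (Summit.QuantumFields.YangMills.Theorems.K0RecordFormatNames.recordK₀ F Mc k + n)).d, ((Hr (⟨b.src, b.dir⟩ : Literature.MathematicalPhysics.QuantumFieldTheory.Balaban1983to89.PBond (F.P (Summit.QuantumFields.YangMills.Theorems.K0RecordFormatNames.recordK₀ F Mc k + n)) 0) + Hr (⟨(b.src).shift b.dir, ν⟩ : Literature.MathematicalPhysics.QuantumFieldTheory.Balaban1983to89.PBond (F.P (Summit.QuantumFields.YangMills.Theorems.K0RecordFormatNames.recordK₀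 F Mc k + n)) 0) - Hr (⟨(b.src).shift ν, b.dir⟩ : Literature.MathematicalPhysics.QuantumFieldTheory.Balaban1983to89.PBond (F.P (Summit.QuantumFields.YangMills.Theorems.K0RecordFormatNames.recordK₀ F Mc k + n)) 0) - Hr (⟨b.src, ν⟩ : Literature.MathematicalPhysics.QuantumFieldTheory.Balaban1983to89.PBond (F.P (Summit.QuantumFields.YangMills.Theorems.K0RecordFormatNames.recordK₀ F Mc k + n)) 0)) - (Hr (⟨b.src.unshift ν, b.dir⟩ : Literature.MathematicalPhysics.QuantumFieldTheory.Balaban1983to89.PBond (F.P (Summit.QuantumFields.YangMills.Theorems.K0RecordFormatNames.recordK₀ F Mc k + n)) 0) + Hr (⟨(b.src.unshift ν).shift b.dir, ν⟩ : Literature.MathematicalPhysics.QuantumFieldTheory.Balaban1983to89.PBond (F.P (Summit.QuantumFields.YangMills.Theorems.K0RecordFormatNames.recordK₀ F Mc k + n)) 0) - Hr (⟨(b.src.unshift ν).shift ν, b.dir⟩ : Literature.MathematicalPhysics.QuantumFieldTheory.Balaban1983to89.PBond (F.P (Summit.QuantumFields.YangMills.Theorems.K0RecordFormatNames.recordK₀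 F Mc k + n)) 0) - Hr (⟨b.src.unshift ν, ν⟩ : Literature.MathematicalPhysics.QuantumFieldTheory.Balaban1983to89.PBond (F.P (Summit.QuantumFields.YangMills.Theorems.K0RecordFormatNames.recordK₀ F Mc k + n)) 0)))‖ ≤ C₉' * (F.P (Summit.QuantumFields.YangMills.Theorems.K0RecordFormatNames.recordK₀ F Mc k + n)).eta (k + 1) ^ 3 * Real.exp (-(δ₉ * (Literature.MathematicalPhysics.QuantumFieldTheory.Balaban1983to89.Site.tdist (Summit.QuantumFields.YangMills.Theorems.K0RecordFormatNames.coarsenTo (k + 1) b.src) y : ℝ)))) → ∀ α₂ : ℝ, 0 < α₂ → ∃ C₉ δ₀ : ℝ, 0 ≤ C₉ ∧ 0 < δ₀ ∧ ∀ k : ℕ, ∀ ε₂₉ : ℝ, 0 < ε₂₉ → (∀ a : (Summit.QuantumFields.YangMills.Theorems.K0RecordFormatNames.thetaFill F a₀ ε₂₉).ιβ, ∀ z₀ : Fin 4 → ℤ, Summit.QuantumFields.YangMills.Theorems.K0RecordFormatNames.Response9DLocAt F (Summit.QuantumFields.YangMills.Theorems.K0RecordFormatNames.thetaFill F a₀ ε₂₉)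 a Mc k (Summit.QuantumFields.YangMills.Theorems.K0RecordFormatNames.recordK₀ F Mc k) (Summit.QuantumFields.YangMills.Theorems.K0RecordFormatNames.nestRadius Mc 5) (Summit.QuantumFields.YangMills.Theorems.K0RecordFormatNames.nestRadius Mc 3) z₀ α₂ C₉ δ₀) ∧ ∀ n : ℕ, letI θ := Summit.QuantumFields.YangMills.Theorems.K0RecordFormatNames.thetaFill F a₀ ε₂₉; letI := θ.instVβ₁; letI := θ.instVβ₂; ContDiffAt ℝ 2 (Summit.QuantumFields.YangMills.Theorems.K0RecordFormatNames.recordEmbJ F θ k (Summit.QuantumFields.YangMills.Theorems.K0RecordFormatNames.recordK₀ F Mc k + n)) 0 ∧ Summit.QuantumFields.YangMills.Theorems.K0RecordFormatNames.recordEmbJ F θ k (Summit.QuantumFields.YangMills.Theorems.K0RecordFormatNames.recordK₀ F Mc k + n) 0 = 0 := by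
  intro F Mc j c c₀ c₁ B₃ B₃' a₀ a₁ hMc hc hc₀ hc₁ hB₃ hB₃' ha₀ ha₁ h8 h9 hE hreg hL α₂ hα₂
  obtain ⟨CL, δL, hCL0, hδL, hLall⟩ := hL
  set A : ℝ := 2 * (2 * CL + 2 * ‖LinearMap.toContinuousLinearMap ((Summit.QuantumFields.YangMills.Theorems.K0RecordFormatNames.sl2Proj).restrictScalars ℝ)‖ * CL + 1) *
    Real.exp (4 * δL * Mc) / α₂ with hA
  have hA0 : 0 ≤ A := by rw [hA]; positivity
  refine ⟨A, δL, hA0, hδL, fun k ε₂₉ hε => ?_⟩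
  letI := (Summit.QuantumFields.YangMills.Theorems.K0RecordFormatNames.thetaFill F a₀ ε₂₉).instVβ₁
  letI := (Summit.QuantumFields.YangMills.Theorems.K0RecordFormatNames.thetaFill F a₀ ε₂₉).instVβ₂
  letI := (Summit.QuantumFields.YangMills.Theorems.K0RecordFormatNames.thetaFill F a₀ ε₂₉).instιβ
  refine ⟨fun a z₀ => ?_, fun n => ⟨?_, ?_⟩⟩
  · -- (C1): `Response9DLocAt … (nestRadius Mc 5) (nestRadius Mc 3) z₀ α₂ A δL` IS `Response9DLocW` for the chart-unit data at the window of radius `6Mc` about `z₀`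
    show Response9DLocW _ _ _ _ _ _ A δL
    refine response9DLocW_fromLocAtξ_of_decayRows hMc (Summit.QuantumFields.YangMills.Theorems.K0RecordFormatNames.thetaFill F a₀ ε₂₉) a k
      (Summit.QuantumFields.YangMills.Theorems.K0RecordFormatNames.nestRadius Mc 5) z₀ _ _ hA0 hδL.le ?_ ?_
    · -- (R1ᴰ-Loc) from the token at `(k, n, ε₂₉, a, y.1, y.2, z₀)`: its □₃-guard holds on every bond of `X` by the row's inner guard
      intro n X y hnw hin
      obtain ⟨μ0, y0⟩ := y
      have htok := hLall k n ε₂₉ hε a μ0 y0 z₀ hnw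
      change gauge _ (B12FormatPlus.cutTo _ (recordGkLocWξ F (thetaFill F a₀ ε₂₉) k (recordK₀ F Mc k + n)
        (recordWindow F k (recordK₀ F Mc k + n) (nestRadius Mc 5) z₀) a (μ0, y0))) ≤ _
      refine rowR1D_Loc_at (F := F) hMc (Nat.le_add_right _ _) a₀ ε₂₉ _ a (μ0, y0) X hα₂ hCL0 hδL.le fun b hb => htok b ?_
      have hi := hin (chartEquivJ F _ (b, Sum.inl 0)) ((chartEquivJ_mem_recordCXJ_iff X b _).2 hb)
      simpa [recordSiteOfJ] using hi
    · -- (R4ᴰ-Loc) from the transport identity: the cut two-volume difference is `0`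
      intro n X hX hn hn' μ z hz
      have h0 : (B12FormatPlus.cutTo (recordCXJ F Mc k (recordK₀ F Mc k + n) X) fun i =>
          recordGkLocAtξ F (thetaFill F a₀ ε₂₉) k (recordK₀ F Mc k + (n + 1)) (nestRadius Mc 5) z₀ a (recordE F k (recordK₀ F Mc k + (n + 1)) μ z)
              (recordJXJ F (recordK₀ F Mc k + n) i) -
            recordGkLocAtξ F (thetaFill F a₀ ε₂₉) k (recordK₀ F Mc k + n) (nestRadius Mc 5) z₀ a (recordE F k (recordK₀ F Mc k + n) μ z) i) = 0 := by
        funext i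
        rw [B12FormatPlus.cutTo_apply]
        split_ifs with hi
        · rw [hT F Mc k a₀ ε₂₉ a z₀ n X hMc hX hn hn' μ z hz i hi, sub_self]
          rfl
        · rfl
      rw [h0, gauge_zero]
      positivity
  · exact contDiffAt_recordEmbJ_of_tokP9reg F a₀ ε₂₉ ha₀ Mc k n (hreg k n ε₂₉ hε)
  · exact recordEmbJ_zero_thetaFill F a₀ ε₂₉ ha₀ Mc k n

end Summit.QuantumFields.YangMills.Theorems.PortU8

end
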